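import Summits.CriticalPhenomena.PercolationContinuityZ3.Theorems.Transplant.AutPolynomialGrowthEndStateConj4
import HarnessLib
import HarnessLib.Audit

/-!
# END-STATE CONTINUITY, named: the chart-free statement a multi-type / quasi-step frames node would deliver (`@[conjecture]`, OPEN — a `Prop`,
# never asserted), and its place in the chain: Conj. 4 ⟹ end-state continuity ⟹ `U_s`; end-state continuity + Trofimov ⟹ Conj. 4 on polynomial growth

builds on p205010 (kernel theorem, internal audit signed; external expert review pending) — nothing in this file uses p205010; NOTHING is claimed about any open node.
Lane `prim-bschramm`, seat `prim-bschramm-p4` gen 27 (PART C3 of `P4-GENERAL.md` §49).  DEFINITIONS (one `@[conjecture] def`) + one-line named forms of the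
corollaries of `AutPolynomialGrowthEndStateConj4` (there stated with the hypothesis written out).  Helper file (`--supports stmt-CriticalPhenomena-4575 --as helper`).

* `BenjaminiSchramm1996_conj4_endState` — **END-STATE CONTINUITY**: `θ_x(p_c) = 0` at every vertex of every connected locally finite graph carrying a subgroup
  `A₀ ≤ Aut(G)` with FINITELY MANY orbits and a homomorphism `A₀ → ℤ²` of RANK-TWO image KILLING EVERY VERTEX STABILISER.  This is Conjecture 4 restricted to the
  END-STATE CLASS of the skeleton ladder (P4-GENERAL §41.5): by gen 26 (`AutDiscrete.aut_virtually_rankTwo_of_frmScaled`) every carrier of any skeleton interface with a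
  discrete automorphism group lies in it, by gen 25 the one-type class (transitive `A₀`) does; `p_c < 1` is automatic on it (`AutChart.criticalProb_lt_one_of_finite_orbits`).
  It is the natural target statement of the planners' end-state node (M)+(Q); it is NOT that node (no chart, steps or cylinders are mentioned) and nothing here types it.
* `conj4_endState_of_conj4` (Conj. 4 ⟹ it), `frmScaledNode₁_of_conj4_endState` (it ⟹ the open one-type node `U_s`),
  `conj4_polynomialGrowth_of_conj4_endState` (it + Trofimov 1985 Thm 2 ⟹ Conj. 4 for EVERY quasi-transitive graph of polynomial growth),
  `heisenberg_of_conj4_endState` (⟹ the Heisenberg target).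
[cite: BenjaminiSchramm1996, Conj. 4; §2 (almost transitive graphs)] [cite: Trofimov1985, Thm. 2] [cite: KozmaNitzan2024, §4 p. 16 (Lemma 8: the role of the lattice symmetries)]
[cite: HermonHutchcroft2021, §1]
-/

noncomputable section

namespace Summit.CriticalPhenomena.PercolationContinuityZ3.Theorems.Transplant

open SimpleGraph Literature.Barriers.CriticalPhenomena Literature.Probability.LatticeModels Literature.Probability.Percolation
open Literature.Combinatorics.SimpleGraph (Trofimov1985_polynomialGrowthBlocks)
open scoped Classical

/-- **END-STATE CONTINUITY (OPEN — a `Prop`, never asserted; NOT in print):** for every connected, locally finite graph `G`, every subgroup `A₀ ≤ Aut(G)` with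
finitely many orbits (a finite set of representatives) and every homomorphism `c : A₀ → ℤ²` of rank-two image with `c a = 0` whenever `a` fixes a vertex:
`θ_x(p_c(G)) = 0` at every vertex.  Conjecture 4 on the end-state class of the skeleton ladder; the target statement of a multi-type / quasi-step frames node.
[cite: BenjaminiSchramm1996, Conj. 4; §2 (almost transitive graphs)] [cite: KozmaNitzan2024, §4 p. 16 (Lemma 8)] -/
@[conjecture] def BenjaminiSchramm1996_conj4_endState : Prop :=
  ∀ {W : Type} (G : SimpleGraph W) [G.LocallyFinite], G.Connected →
    ∀ (A₀ : Subgroup (G ≃g G)) (reps : Finset W) (c : A₀ →* Multiplicative (Site 2)),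
      (∀ w : W, ∃ a : A₀, ∃ s ∈ reps, (a : G ≃g G) s = w) → (∀ (a : A₀) (w : W), (a : G ≃g G) w = w → c a = 1) →
      (∃ a b : A₀, MaxArea.det2 (Multiplicative.toAdd (c a)) (Multiplicative.toAdd (c b)) ≠ 0) →
        ∀ x : W, theta G x (criticalProbIOf G x) = 0

/-- **Conjecture 4 ⟹ end-state continuity** (the end-state class is quasi-transitive with `p_c < 1`). [cite: BenjaminiSchramm1996, Conj. 4] -/
theorem conj4_endState_of_conj4 (h : BenjaminiSchramm1996_conj4) : BenjaminiSchramm1996_conj4_endState :=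
  fun G _ hc A₀ reps c horb hstab hrank x => AutPoly.endState_of_conj4 h G hc A₀ reps c horb hstab hrank x

/-- **End-state continuity ⟹ the open one-type node `U_s`** (`SamePDropOfSkeletonFrmScaled₁`). [cite: BenjaminiSchramm1996, Conj. 4] -/
theorem frmScaledNode₁_of_conj4_endState (hE : BenjaminiSchramm1996_conj4_endState) : SamePDropOfSkeletonFrmScaled₁ :=
  AutPoly.frmScaledNode₁_of_endState hE

/-- **End-state continuity + Trofimov 1985 Thm 2 ⟹ Conjecture 4 for EVERY quasi-transitive graph of polynomial growth.**
[cite: BenjaminiSchramm1996, Conj. 4] [cite: Trofimov1985, Thm. 2] -/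
theorem conj4_polynomialGrowth_of_conj4_endState (hT : Trofimov1985_polynomialGrowthBlocks) (hE : BenjaminiSchramm1996_conj4_endState) :
    BenjaminiSchramm1996_conj4_polynomialGrowth :=
  AutPoly.conj4_polynomialGrowth_of_endState hT hE

/-- **… in particular the Heisenberg target.** [cite: BenjaminiSchramm1996, Conj. 4] [cite: Trofimov1985, Thm. 2] -/
theorem heisenberg_of_conj4_endState (hT : Trofimov1985_polynomialGrowthBlocks) (hE : BenjaminiSchramm1996_conj4_endState) :
    HeisenbergCriticalContinuity :=
  AutPoly.heisenberg_of_endState hT hE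

end Summit.CriticalPhenomena.PercolationContinuityZ3.Theorems.Transplant

end
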